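import Literature.AlgebraicGeometry.Resolution.SeparatingBlowup
import Literature.AlgebraicGeometry.Resolution.StrictTransformPersistence
import Literature.AlgebraicGeometry.Resolution.BlowupsExistence
import HarnessLib

/-!
# Separating the closures of two disjoint constructible closed subsets of `U` by a
# `U`-admissible blowing up (Stacks 0F3V (2))

Topic: `Literature/AlgebraicGeometry/Resolution`. The Stacks Project, Tag 0F3V (More on Flatness,
Lemma 38.33.2), part (2): "Let `X` be a quasi-compact and quasi-separated scheme. Let `U ⊂ X` be
a quasi-compact open. […] (2) If `T₁, T₂ ⊂ U` are disjoint constructible closed subsets, then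
there is a `U`-admissible blowing up `X' → X` such that the closures of `T₁` and `T₂` are
disjoint." It is used twice in the proof of Nagata's compactification theorem (Tag 0F41: in
Lemma 0F3W, and in Lemma 0F40 to separate `Z̄ᵢ,ᵢ` from `Z̄ᵢ,ⱼ`). PROVED, following the printed
proof through part (1) and Divisors, Lemma 31.35.5 (Tag 080P, `SeparatingBlowup.lean`):

* finite type ideal sheaves `𝓖ₖ` on `X` with `V(𝓖ₖ) ∩ U = Tₖ` (`exists_fg_support_eq_compl`
  applied to the quasi-compact opens `U ∖ Tₖ`); the centre is `𝓒 = 𝓖₁ + 𝓖₂`, of finite type,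
  with `V(𝓒) ∩ U = T₁ ∩ T₂ = ∅`;
* on the closed subscheme `Z = V(𝓖₁𝓖₂)` the ideal sheaves `𝓘 = 𝓖₁𝒪_Z`, `𝓙 = 𝓖₂𝒪_Z` satisfy
  `𝓘𝓙 = 0`, and the strict transform `Z'' → Z` of `Z ↪ X` along the blowing up `b : X' → X` in
  `𝓒` is a blowing up of `Z` in `𝓒𝒪_Z = 𝓘 + 𝓙` (Tag 080E, `isBlowup_blowupStrictTransform`), so
  by Tag 080P (`vanishingOpen_sup_vanishingOpen_eq_top`, `vanishingOpen_inf_vanishingOpen_eq_bot`,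
  `preimage_centreCompl_le_vanishingOpen`) `Z''` is the disjoint union of the open loci
  `A₁ = {𝓙𝒪 = 0} ⊇ (Z'' → Z)⁻¹(Z ∖ V(𝓘))` and `A₂ = {𝓘𝒪 = 0} ⊇ (Z'' → Z)⁻¹(Z ∖ V(𝓙))`;
* `b⁻¹(T₂)` lies in the image of `A₁` and `b⁻¹(T₁)` in the image of `A₂` under the closed
  immersion `Z'' → X'` (over `U` the strict transform is all of `Z ×_X X'`, and a point of `T₂`
  is not in `V(𝓖₁)`), two disjoint closed subsets of `X'`.

* `stacks0F3V` — the statement, with the `U`-admissible blowing up rendered as usual by an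
  ideal sheaf of finite type with support disjoint from `U` and `IsBlowup`.

## References

* The Stacks Project, Tag 0F3V (Lemma 38.33.2) and its proof; Tags 080P, 080E. [StacksProject]
-/

noncomputable section

-- Mathlib's pull-back API is stated through `abbrev`s over `limit`; as in Mathlib's own
-- algebraic-geometry files we let `simp`/unification see through them.
set_option backward.isDefEq.respectTransparency false

open CategoryTheory CategoryTheory.Limits AlgebraicGeometry TopologicalSpace

namespace Literature.AlgebraicGeometry.Resolution

universe u

variable {X : Scheme.{u}}

/-- A point of the open `O ⊆ T` lies in the image of `im(O ↪ T) → T`. [folklore] -/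
theorem mem_range_imageι_of_mem {T : Scheme.{u}} (O : T.Opens) {z : T} (hz : z ∈ O) :
    z ∈ Set.range O.ι.imageι :=
  ⟨O.ι.toImage ⟨z, hz⟩, by rw [← Scheme.Hom.comp_apply, Scheme.Hom.toImage_imageι]; rfl⟩

/-- **Stacks 0F3V (2).** Let `X` be quasi-compact and quasi-separated, `U ⊆ X` an open and
`T₁, T₂ ⊆ U` disjoint closed subsets of `U` with quasi-compact complements `U ∖ Tₖ` (for `U`
quasi-compact: constructible closed subsets of `U`; the quasi-compactness of `U` itself, assumed
in the printed statement, is not needed). Then there is a `U`-admissible blowing up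
`b : X' → X` (the blowing up in an ideal sheaf of finite type whose support does not meet `U`)
such that the closures of `b⁻¹(T₁)` and `b⁻¹(T₂)` in `X'` are disjoint.
[cite: StacksProject, Tag 0F3V] -/
theorem stacks0F3V [CompactSpace X] [QuasiSeparatedSpace X] (U : X.Opens)
    (T₁ T₂ : Set X) (hT₁U : T₁ ⊆ U) (hT₂U : T₂ ⊆ U)
    (hO₁ : IsOpen ((U : Set X) \ T₁)) (hO₂ : IsOpen ((U : Set X) \ T₂))
    (hO₁c : IsCompact ((U : Set X) \ T₁)) (hO₂c : IsCompact ((U : Set X) \ T₂))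
    (hT : Disjoint T₁ T₂) :
    ∃ (C : X.IdealSheafData) (X' : Scheme.{u}) (b : X' ⟶ X),
      (∀ W : X.affineOpens, (C.ideal W).FG) ∧ Disjoint (U : Set X) (C.support : Set X) ∧
      IsBlowup b C ∧ Disjoint (closure (b ⁻¹' T₁)) (closure (b ⁻¹' T₂)) := by
  -- finite type ideal sheaves `𝓖ₖ` with `V(𝓖ₖ) = X ∖ (U ∖ Tₖ)`, so `V(𝓖ₖ) ∩ U = Tₖ`
  obtain ⟨G₁, hG₁fg, hG₁supp⟩ := exists_fg_support_eq_compl (X := X) ⟨_, hO₁⟩ hO₁c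
  obtain ⟨G₂, hG₂fg, hG₂supp⟩ := exists_fg_support_eq_compl (X := X) ⟨_, hO₂⟩ hO₂c
  simp only [Opens.coe_mk] at hG₁supp hG₂supp
  have hT₂G₁ : ∀ t ∈ T₂, t ∉ (G₁.support : Set X) := fun t ht h => by
    rw [hG₁supp] at h
    exact h ⟨hT₂U ht, fun h1 => Set.disjoint_left.mp hT h1 ht⟩
  have hT₁G₂ : ∀ t ∈ T₁, t ∉ (G₂.support : Set X) := fun t ht h => by
    rw [hG₂supp] at h
    exact h ⟨hT₁U ht, fun h2 => Set.disjoint_left.mp hT ht h2⟩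
  have hT₁G₁ : T₁ ⊆ (G₁.support : Set X) := fun t ht => by
    rw [hG₁supp]
    exact fun h => h.2 ht
  have hT₂G₂ : T₂ ⊆ (G₂.support : Set X) := fun t ht => by
    rw [hG₂supp]
    exact fun h => h.2 ht
  -- the centre `𝓒 = 𝓖₁ + 𝓖₂`
  set C : X.IdealSheafData := G₁ ⊔ G₂ with hC
  have hCfg : ∀ W : X.affineOpens, (C.ideal W).FG := fun W => by
    rw [hC, Scheme.IdealSheafData.ideal_sup, Pi.sup_apply]
    exact Submodule.FG.sup (hG₁fg W) (hG₂fg W)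
  have hCU : Disjoint (U : Set X) (C.support : Set X) := by
    refine Set.disjoint_left.mpr fun x hxU hxC => ?_
    rw [hC, Scheme.IdealSheafData.support_sup, Closeds.coe_inf, hG₁supp, hG₂supp] at hxC
    exact hxC.1 ⟨hxU, fun h1 => hxC.2 ⟨hxU, fun h2 => Set.disjoint_left.mp hT h1 h2⟩⟩
  obtain ⟨X', b, hb⟩ := exists_isBlowup X C
  refine ⟨C, X', b, hCfg, hCU, hb, ?_⟩
  /- the closed subscheme `Z = V(𝓖₁ 𝓖₂)` and the ideal sheaves `𝓘 = 𝓖₁𝒪_Z`, `𝓙 = 𝓖₂𝒪_Z` -/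
  set i := (G₁ * G₂).subschemeι with hi
  set I := G₁.comap i with hI
  set J := G₂.comap i with hJ
  have hIJ : I * J = ⊥ := by
    have h := comap_ker_self_eq_bot i
    rw [hi, Scheme.IdealSheafData.ker_subschemeι] at h
    rw [hI, hJ, ← comap_mul, hi]
    exact h
  have hIfg : ∀ W, (I.ideal W).FG := fg_ideal_comap i hG₁fg
  have hJfg : ∀ W, (J.ideal W).FG := fg_ideal_comap i hG₂fg
  -- the strict transform `Z'' → Z` of `Z ↪ X` along `b` is a blowing up in `𝓒𝒪_Z = 𝓘 + 𝓙`
  set bZ := blowupStrictTransformι i b C ≫ pullback.fst i b with hbZ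
  have hbZ' : IsBlowup bZ (I ⊔ J) := by
    have h := isBlowup_blowupStrictTransform i b C hb
    rwa [hC, Scheme.IdealSheafData.comap_sup] at h
  have hE : IsEffectiveCartier ((I ⊔ J).comap bZ) := hbZ'.isEffectiveCartier
  -- Stacks 080P: `Z''` is the disjoint union of `A₁ = {𝓙𝒪 = 0}` and `A₂ = {𝓘𝒪 = 0}`
  set A₁ := vanishingOpen (J.comap bZ) with hA₁
  set A₂ := vanishingOpen (I.comap bZ) with hA₂
  have htop : A₁ ⊔ A₂ = ⊤ := vanishingOpen_sup_vanishingOpen_eq_top I J bZ hIfg hJfg hIJ hE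
  have hbot : A₁ ⊓ A₂ = ⊥ := vanishingOpen_inf_vanishingOpen_eq_bot I J bZ hE
  have hle₁ : bZ ⁻¹ᵁ centreCompl I ≤ A₁ := preimage_centreCompl_le_vanishingOpen I J bZ hIJ
  have hle₂ : bZ ⁻¹ᵁ centreCompl J ≤ A₂ :=
    preimage_centreCompl_le_vanishingOpen J I bZ ((mul_comm _ _).trans hIJ)
  -- the closed immersion `c : Z'' → X'`
  set c := blowupStrictTransformMap i b C with hc
  haveI : IsClosedImmersion c :=
    inferInstanceAs (IsClosedImmersion (blowupStrictTransformι i b C ≫ pullback.snd i b))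
  -- `A₁`, `A₂` are closed (complements of each other), hence so are their images
  have hA₁A₂ : (A₁ : Set (blowupStrictTransform i b C)) = (A₂ : Set (blowupStrictTransform i b C))ᶜ := by
    refine Set.Subset.antisymm (fun x hx hx' => ?_) (fun x hx => ?_)
    · have : x ∈ ((A₁ ⊓ A₂ : (blowupStrictTransform i b C).Opens) : Set (blowupStrictTransform i b C)) := ⟨hx, hx'⟩
      rw [hbot] at this
      exact this
    · have hx' : x ∈ ((A₁ ⊔ A₂ : (blowupStrictTransform i b C).Opens) : Set (blowupStrictTransform i b C)) := by rw [htop]; trivial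
      rcases hx' with h | h
      · exact h
      · exact (hx h).elim
  have hA₁cl : IsClosed (A₁ : Set (blowupStrictTransform i b C)) := by rw [hA₁A₂]; exact A₂.2.isClosed_compl
  have hA₂cl : IsClosed (A₂ : Set (blowupStrictTransform i b C)) := by
    rw [← compl_compl (A₂ : Set (blowupStrictTransform i b C)), ← hA₁A₂]; exact A₁.2.isClosed_compl
  have hcA₁ : IsClosed (c '' (A₁ : Set (blowupStrictTransform i b C))) := c.isClosedEmbedding.isClosedMap _ hA₁cl
  have hcA₂ : IsClosed (c '' (A₂ : Set (blowupStrictTransform i b C))) := c.isClosedEmbedding.isClosedMap _ hA₂cl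
  have hdisj : Disjoint (c '' (A₂ : Set (blowupStrictTransform i b C))) (c '' (A₁ : Set (blowupStrictTransform i b C))) := by
    rw [Set.disjoint_image_iff c.isClosedEmbedding.injective, hA₁A₂]
    exact disjoint_compl_right
  -- points of `X'` over `Tₖ` come from `Z''`, over `Z ∖ V(𝓘)` resp. `Z ∖ V(𝓙)`
  have key : ∀ (T : Set X) (G K : X.IdealSheafData) (A : (blowupStrictTransform i b C).Opens),
      T ⊆ U → (∀ t ∈ T, t ∉ (G.support : Set X)) → T ⊆ (K.support : Set X) →
      K.support ≤ (G₁ * G₂).support → bZ ⁻¹ᵁ centreCompl (G.comap i) ≤ A →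
      b ⁻¹' T ⊆ c '' (A : Set (blowupStrictTransform i b C)) := by
    intro T G K A hTU hTG hTK hK hA x' hx'
    -- `x'` lies over `U ⊆ X ∖ V(𝓒)` and over `Z`
    have hxU : b x' ∈ (centreCompl C : X.Opens) := fun h => Set.disjoint_left.mp hCU (hTU hx') h
    have hxZ : b x' ∈ Set.range i := by
      rw [hi, Scheme.IdealSheafData.range_subschemeι]
      exact hK (hTK hx')
    -- the point `z ∈ Z ×_X X'` over `x'` lies in the open over `b⁻¹(X ∖ V(𝓒))`, hence in `Z''`
    obtain ⟨z, hz⟩ : x' ∈ Set.range (pullback.snd i b) := by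
      rw [Scheme.Pullback.range_snd]; exact hxZ
    have hzO : z ∈ ((pullback.snd i b) ⁻¹ᵁ (b ⁻¹ᵁ centreCompl C) : (pullback i b).Opens) := by
      show b (pullback.snd i b z) ∈ (centreCompl C : X.Opens)
      rw [hz]; exact hxU
    obtain ⟨z'', hz''⟩ := mem_range_imageι_of_mem _ hzO
    refine ⟨z'', hA ?_, ?_⟩
    · -- `bZ z''` maps to `b x' ∉ V(G)` under `i`
      show bZ z'' ∈ (centreCompl (G.comap i) : Opens _)
      simp only [centreCompl, Scheme.IdealSheafData.support_comap, Opens.mem_mk, Set.mem_compl_iff,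
        Closeds.coe_preimage, Set.mem_preimage]
      have : i (bZ z'') = b x' := by
        rw [hbZ, ← Scheme.Hom.comp_apply, Category.assoc, pullback.condition, Scheme.Hom.comp_apply,
          Scheme.Hom.comp_apply]
        erw [hz'']
        rw [hz]
      rw [this]
      exact hTG _ hx'
    · show (blowupStrictTransformι i b C ≫ pullback.snd i b) z'' = x'
      rw [Scheme.Hom.comp_apply]
      erw [hz'']
      exact hz
  have h₂ : b ⁻¹' T₂ ⊆ c '' (A₁ : Set (blowupStrictTransform i b C)) :=
    key T₂ G₁ G₂ A₁ hT₂U hT₂G₁ hT₂G₂ (by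
      rw [Scheme.IdealSheafData.support_mul]; exact le_sup_right) hle₁
  have h₁ : b ⁻¹' T₁ ⊆ c '' (A₂ : Set (blowupStrictTransform i b C)) :=
    key T₁ G₂ G₁ A₂ hT₁U hT₁G₂ hT₁G₁ (by
      rw [Scheme.IdealSheafData.support_mul]; exact le_sup_left) hle₂
  exact hdisj.mono (hcA₂.closure_subset_iff.mpr h₁) (hcA₁.closure_subset_iff.mpr h₂)

end Literature.AlgebraicGeometry.Resolution

end
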